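import Literature.Geometry.Lorentzian.SchwarzschildArealTail
import Literature.Geometry.Lorentzian.MinkowskiLateChart
import Literature.Geometry.Manifold.OpenSubmanifoldMFDeriv
import HarnessLib

/-!
# The Schwarzschild exterior in static coordinates inhabits the typed quasi-final late-chart clauses
# (Ellithy 2026, Def. 4.4 (1)+(2), §4.1; manifold level)

A. Ellithy, *The spacetime Penrose inequality under a quasi final state hypothesis*, arXiv:2605.18730
(2026), Def. 4.4 (p. 39), §4.1 (p. 38), Remark 4.6 (p. 40: "the stationary Kerr and Schwarzschild
exteriors are compatible with the final-state hypotheses"); J. B. Griffiths, J. Podolský, *Exact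
space-times* (2009), §8.1, (8.1).

`SchwarzschildArealTail` shows that the CARTESIAN MODEL `(ℝ × E3, g_static)` of the exact Schwarzschild
exterior (areal gauge, static slices) satisfies `IsQuasiFinalAnalytic` with the polar late chart.  This
module transports that to an honest Lorentzian manifold of the tree: the open submanifold
`Kerr.exterior m 0 = {(t, x⃗) ∈ ℝ⁴ | |x⃗| > max(r₊, 0)}` of `E4` with the static Schwarzschild metric
`Schwarzschild.staticMetric m` of `SchwarzschildStaticChart` (a `C^∞` Lorentzian metric under the
prelude's standing hypothesis class `[Kerr.Facts]`; by construction isometric to the Kerr–Schild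
Schwarzschild metric `Kerr.smoothMetric m 0 r₊` through the Eddington–Finkelstein change of time,
`Schwarzschild.isIsometry_toKerrSchild`), model `𝓘(ℝ, E4) = 𝓡 4`:

* `Schwarzschild.lateChart m r₀ hr₀ hm : ℝ × ℝ × S² → Kerr.exterior m 0`, `(t, r, p) ↦ (t, r p)` for
  `r |p| > max(r₊, 0)` (a fixed base point otherwise — never met on the late exterior `r > r₀ ≥ 4|m|`);
* `Schwarzschild.pullbackBilin_lateChart` — off `|y| ≤ r₀` the chart metric is the static form
  `schwarzschildStaticForm m (t, y)` (`= -(1-2m/r) dt² + dy² + (2m/(r-2m)) dr²`): the inclusion of the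
  open submanifold has identity differential (`OpenSubmanifold.hasMFDerivAt_subtype_val`) and the chart
  read in `E4` is the linear map `toE4`;
* `Schwarzschild.staticMetric_hasADMForm`, `Schwarzschild.staticMetric_isQuasiFinalAnalytic` — the
  ADM-form clause with the areal tuple `schwarzschildAreal m`, and Def. 4.4 (1)+(2)+§4.1
  (`IsQuasiFinalAnalytic 𝓘(ℝ, E4) (M := Kerr.exterior m 0) (Schwarzschild.staticMetric m).val Φ T̲ r₀`)
  for every `r₀ > 0` with `r₀ ≥ 4|m|` and every `T̲` — the positive-mass, manifold-level counterpart of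
  `Minkowski.spacetime_isQuasiFinalAnalytic`.

* § Collar: the COLLAR SENTENCE of Def. 4.4 (1) at manifold level —
  `Schwarzschild.staticMetric_hasUniformCollarControl`, `Schwarzschild.staticMetric_isQuasiFinalAnalyticCollar`
  (`HasUniformCollarControl` / `IsQuasiFinalAnalyticCollar` of `QuasiFinalCollarControl`), transported from the
  Cartesian model (`TailClassModel.schwarzschildStatic_hasUniformCollarControl`) along the shared ADM tuple:
  the collar sentence reads the chart only through the chart metric on the open late exterior
  (`HasUniformCollarControl.of_hasADMForm`), and both charts have the ADM form of `schwarzschildAreal m`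
  there (`TailClassModel.schwarzschildStatic_hasADMForm`, `Schwarzschild.staticMetric_hasADMForm`).

The orientation clause of §4.1 (Cauchy temporal chart time) is not addressed in this module.  A model of
a hypothesis class proves nothing about any summit; no facts are introduced; the manifold-level
statements are conditional on the prelude's standing hypothesis class `[Kerr.Facts]` exactly as
`Schwarzschild.staticMetric` is.

## References

* [Ellithy2026] A. Ellithy, arXiv:2605.18730 (2026), Def. 4.4 (p. 39), §4.1 (p. 38), Rem. 4.6 (p. 40).
* [GriffithsPodolsky2009] J. B. Griffiths, J. Podolský, *Exact space-times in Einstein's general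
  relativity*, CUP 2009, §8.1, (8.1).
-/

noncomputable section

open Set Metric Function Filter
open scoped Manifold ContDiff Topology RealInnerProductSpace
open Literature.Geometry.Lorentzian Literature.Geometry.Lorentzian.TailClassModel

namespace Literature.Geometry.Lorentzian

namespace Schwarzschild

variable {m r₀ : ℝ}

/-- `r₊(m, 0) = m + |m| ≤ 2|m|`. [folklore] -/
private theorem rPlus_zero_le (m : ℝ) : Kerr.rPlus m 0 ≤ 2 * |m| := by
  have h : Real.sqrt (m ^ 2 - 0 ^ 2) = |m| := by
    rw [zero_pow two_ne_zero, sub_zero, Real.sqrt_sq_eq_abs]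
  rw [Kerr.rPlus, h]
  linarith [le_abs_self m]

/-- A point `(t, y)` with `|y| > r₀ ≥ 4|m|`, `r₀ > 0`, lies in the exterior chart `Kerr.exterior m 0`.
[cite: Ellithy2026, Def. 4.4, p. 39] -/
theorem ofTimeSpace_mem_exterior (hr₀ : 0 < r₀) (hm : 4 * |m| ≤ r₀) (t : ℝ) {y : E3}
    (hy : r₀ < ‖y‖) : E4.ofTimeSpace t y ∈ Kerr.exterior m 0 := by
  rw [Kerr.mem_exterior, Kerr.radius_zero_left, E4.spatialNorm_ofTimeSpace, max_lt_iff]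
  have := rPlus_zero_le m
  exact ⟨by linarith [abs_nonneg m], hr₀.trans hy⟩

/-- A base point of the exterior chart (junk value of the late chart off its domain). [folklore] -/
private def basePoint (hr₀ : 0 < r₀) (hm : 4 * |m| ≤ r₀) : Kerr.exterior m 0 :=
  ⟨E4.ofTimeSpace 0 ((r₀ + 1) • (northPole : E3)), ofTimeSpace_mem_exterior hr₀ hm 0 (by
    rw [norm_smul, Real.norm_eq_abs, abs_of_pos (by linarith)]
    simp)⟩

open scoped Classical in
/-- **The late polar chart of the static Schwarzschild exterior**: `Φ(t, r, p) = (t, r p) ∈ Kerr.exterior m 0`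
whenever `(t, r p)` lies in the chart domain `{|x⃗| > max(r₊, 0)}` (in particular for `r > r₀ ≥ 4|m|`),
a fixed base point otherwise. [cite: Ellithy2026, Def. 4.4, p. 39] -/
def lateChart (m r₀ : ℝ) (hr₀ : 0 < r₀) (hm : 4 * |m| ≤ r₀) :
    ℝ × ℝ × sphere (0 : E3) 1 → Kerr.exterior m 0 := fun q ↦
  if h : Minkowski.lateChart q ∈ Kerr.exterior m 0 then ⟨Minkowski.lateChart q, h⟩ else basePoint hr₀ hm

/-- Off `|y| ≤ r₀` the chart read in Cartesian slice coordinates is `toE4` followed by the inclusion: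
`↑(Φ ∘ polar)(t, y) = (t, y)`. [cite: Ellithy2026, Def. 4.4, p. 39] -/
theorem coe_polarChart_lateChart (hr₀ : 0 < r₀) (hm : 4 * |m| ≤ r₀) {q : ℝ × E3} (hq : r₀ < ‖q.2‖) :
    ((polarChart (lateChart m r₀ hr₀ hm) q : Kerr.exterior m 0) : E4) = toE4 q := by
  have hq0 : q.2 ≠ 0 := norm_pos_iff.mp (hr₀.trans hq)
  have h1 : polarChart Minkowski.lateChart q = toE4 q := Minkowski.polarChart_lateChart_eq hq0
  have hmem : Minkowski.lateChart (q.1, ‖q.2‖, raySphere q.2) ∈ Kerr.exterior m 0 := by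
    have : Minkowski.lateChart (q.1, ‖q.2‖, raySphere q.2) = toE4 q := h1
    rw [this, toE4_apply]
    exact ofTimeSpace_mem_exterior hr₀ hm q.1 hq
  simp only [polarChart, lateChart]
  rw [dif_pos hmem]
  exact h1

/-- The same, eventually near such a point (the condition `|y| > r₀` is open). [cite: Ellithy2026, Def. 4.4, p. 39] -/
theorem coe_polarChart_lateChart_eventuallyEq (hr₀ : 0 < r₀) (hm : 4 * |m| ≤ r₀) {q : ℝ × E3}
    (hq : r₀ < ‖q.2‖) :
    (Subtype.val ∘ polarChart (lateChart m r₀ hr₀ hm)) =ᶠ[𝓝 q] (toE4 : ℝ × E3 → E4) := by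
  have hopen : IsOpen {q' : ℝ × E3 | r₀ < ‖q'.2‖} := isOpen_lt continuous_const continuous_snd.norm
  exact Filter.eventuallyEq_of_mem (hopen.mem_nhds hq) fun q' hq' ↦ coe_polarChart_lateChart hr₀ hm hq'

/-- The late chart read in slice coordinates is smooth near the late exterior points (as a map into the
open submanifold). [cite: Ellithy2026, Def. 4.4, p. 39] -/
theorem contMDiffAt_polarChart_lateChart (hr₀ : 0 < r₀) (hm : 4 * |m| ≤ r₀) {q : ℝ × E3}
    (hq : r₀ < ‖q.2‖) :
    ContMDiffAt 𝓘(ℝ, ℝ × E3) 𝓘(ℝ, E4) ∞ (polarChart (lateChart m r₀ hr₀ hm)) q := by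
  rw [← ContMDiffAt.subtypeVal_comp_iff]
  exact (toE4.contDiff.contMDiff.contMDiffAt (n := ∞)).congr_of_eventuallyEq
    (coe_polarChart_lateChart_eventuallyEq hr₀ hm hq)

/-- **The differential of the late chart in slice coordinates is `toE4`** at the late exterior points
(the inclusion of the open submanifold `Kerr.exterior m 0 ⊆ E4` has identity differential).
[cite: Ellithy2026, Def. 4.4, p. 39] -/
theorem mfderiv_polarChart_lateChart (hr₀ : 0 < r₀) (hm : 4 * |m| ≤ r₀) {q : ℝ × E3}
    (hq : r₀ < ‖q.2‖) :
    mfderiv 𝓘(ℝ, ℝ × E3) 𝓘(ℝ, E4) (polarChart (lateChart m r₀ hr₀ hm)) q = toE4 := by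
  have hd : MDifferentiableAt 𝓘(ℝ, ℝ × E3) 𝓘(ℝ, E4) (polarChart (lateChart m r₀ hr₀ hm)) q :=
    (contMDiffAt_polarChart_lateChart hr₀ hm hq).mdifferentiableAt (by simp)
  have h1 : HasMFDerivAt 𝓘(ℝ, ℝ × E3) 𝓘(ℝ, E4) (Subtype.val ∘ polarChart (lateChart m r₀ hr₀ hm)) q
      ((ContinuousLinearMap.id ℝ E4).comp
        (mfderiv 𝓘(ℝ, ℝ × E3) 𝓘(ℝ, E4) (polarChart (lateChart m r₀ hr₀ hm)) q)) :=
    (Literature.Geometry.Manifold.OpenSubmanifold.hasMFDerivAt_subtype_val _).comp q hd.hasMFDerivAt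
  have h2 : mfderiv 𝓘(ℝ, ℝ × E3) 𝓘(ℝ, E4) (Subtype.val ∘ polarChart (lateChart m r₀ hr₀ hm)) q = toE4 := by
    rw [(coe_polarChart_lateChart_eventuallyEq hr₀ hm hq).mfderiv_eq, ContinuousLinearMap.mfderiv_eq]
  rw [h1.mfderiv, ContinuousLinearMap.id_comp] at h2
  exact h2

variable [Kerr.Facts]

/-- **The chart metric of the static Schwarzschild exterior in its late chart is the static form**
`g_static(t, y) = -(1 - 2m/|y|) dt² + dy² + (2m/(|y| - 2m)) dr²` (`schwarzschildStaticForm`), at every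
slice point with `|y| > r₀ ≥ 4|m|`. [cite: GriffithsPodolsky2009, §8.1 (8.1)] -/
theorem pullbackBilin_lateChart (hr₀ : 0 < r₀) (hm : 4 * |m| ≤ r₀) {q : ℝ × E3} (hq : r₀ < ‖q.2‖) :
    pullbackBilin (I := 𝓘(ℝ, E4)) (I' := 𝓘(ℝ, ℝ × E3)) (polarChart (lateChart m r₀ hr₀ hm))
        (staticMetric m).val q = schwarzschildStaticForm m q := by
  obtain ⟨t, y⟩ := q
  have hy : r₀ < ‖y‖ := hq
  refine ContinuousLinearMap.ext fun v ↦ ContinuousLinearMap.ext fun w ↦ ?_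
  rw [pullbackBilin_apply, mfderiv_polarChart_lateChart hr₀ hm hq, staticMetric_val]
  have hx : ((polarChart (lateChart m r₀ hr₀ hm) (t, y) : Kerr.exterior m 0) : E4) = E4.ofTimeSpace t y :=
    coe_polarChart_lateChart hr₀ hm hq
  have key : ∀ x : E4, x = E4.ofTimeSpace t y →
      staticBilin m x (toE4 v) (toE4 w) = schwarzschildStaticForm m (t, y) v w := by
    rintro x rfl
    rw [toE4_apply, toE4_apply]
    exact (schwarzschildStaticForm_eq_staticBilin hr₀ hm t hy v w).symm
  exact key _ hx

/-- **The static Schwarzschild exterior has the ADM form of the areal tuple in its late chart**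
(Def. 4.4 (1), ADM-form clause; `N = (1-2m/r)^{1/2}`, `λ = N⁻¹`, `β = 0`, `γ = r² γ_{S²}`), every
`r₀ > 0` with `r₀ ≥ 4|m|`, every `T̲`. [cite: Ellithy2026, Def. 4.4, p. 39] -/
theorem staticMetric_hasADMForm (hr₀ : 0 < r₀) (hm : 4 * |m| ≤ r₀) (Tlo : ℝ) :
    HasADMForm 𝓘(ℝ, E4) (M := Kerr.exterior m 0) (staticMetric m).val (lateChart m r₀ hr₀ hm) Tlo r₀
      (schwarzschildAreal m) := by
  intro t y _ hy
  exact pullbackBilin_lateChart hr₀ hm (q := (t, y)) hy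

/-- **The Schwarzschild exterior `(Kerr.exterior m 0, g_static)` with its late chart satisfies the typed
analytic clauses `IsQuasiFinalAnalytic` of the quasi final state hypothesis** — Def. 4.4 (1) (ADM form,
coefficient tuple in `𝒞𝒮♯_{-τ}`), (2) (gauge reducibility, forcing decay) and the §4.1 rest frame — for
every `r₀ > 0` with `r₀ ≥ 4|m|` and every `T̲` (witnesses `α = 1/2`, `τ = 3/4`,
`𝒮 = schwarzschildAreal m`); the positive-mass, manifold-level analogue of
`Minkowski.spacetime_isQuasiFinalAnalytic`.  The geometric clauses of Def. 4.4 about the horizon and the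
orientation clause are not part of this predicate. [cite: Ellithy2026, Def. 4.4, p. 39; Remark 4.6, p. 40] -/
theorem staticMetric_isQuasiFinalAnalytic (hr₀ : 0 < r₀) (hm : 4 * |m| ≤ r₀) (Tlo : ℝ) :
    IsQuasiFinalAnalytic 𝓘(ℝ, E4) (M := Kerr.exterior m 0) (staticMetric m).val (lateChart m r₀ hr₀ hm)
      Tlo r₀ :=
  ⟨hr₀, 1 / 2, ⟨by norm_num, by norm_num⟩, 3 / 4, ⟨by norm_num, by norm_num⟩, schwarzschildAreal m,
    staticMetric_hasADMForm hr₀ hm Tlo,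
    schwarzschildAreal_isSharpTailCoeff hr₀ hm (by norm_num) (by norm_num) (by norm_num) Tlo,
    schwarzschildAreal_isGaugeReducible hr₀ hm (by norm_num) (by norm_num) (by norm_num) Tlo,
    schwarzschildAreal_hasLateForcingDecay hr₀ hm _ _ Tlo, radial_isRestFrame _ _ Tlo⟩

end Schwarzschild

/-! ### The collar sentence of Def. 4.4 (1) at manifold level -/

namespace TailClassModel

variable {m r₀ : ℝ}

/-- The Cartesian model `(ℝ × E3, g_static)` has the ADM form of the areal tuple `schwarzschildAreal m` in
its polar late chart, every `r₀ > 0`, `T̲` (the `HasADMForm` clause inside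
`schwarzschildStatic_isQuasiFinalAnalytic`, isolated: `Φ ∘ polar = id` off the axis,
`pullbackBilin_minkPolarChart_of`, and `g_static(t, y)` IS `(schwarzschildAreal m).admForm t y`).
[cite: Ellithy2026, Def. 4.4, p. 39] -/
theorem schwarzschildStatic_hasADMForm (hr₀ : 0 < r₀) (Tlo : ℝ) :
    HasADMForm 𝓘(ℝ, ℝ × E3) (M := ℝ × E3) (schwarzschildStaticForm m) minkPolarChart Tlo r₀
      (schwarzschildAreal m) :=
  fun t y _ hy ↦ pullbackBilin_minkPolarChart_of _ (q := (t, y)) (norm_pos_iff.mp (hr₀.trans hy))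

end TailClassModel

namespace Schwarzschild

variable {m r₀ : ℝ} [Kerr.Facts]

/-- **The collar sentence of Def. 4.4 (1) for the Schwarzschild exterior `(Kerr.exterior m 0, g_static)`
in its late chart** ("The coordinate system has uniform `C²` control on fixed collars of `𝓗_final` for
all sufficiently late `t`", as typed by `HasUniformCollarControl`): every `r₀ > 0` with `r₀ ≥ 4|m|`,
every `T̲`.  It is the model-level control `TailClassModel.schwarzschildStatic_hasUniformCollarControl`
(width `r₀/4`, the explicit static field `schwarzschildStaticField m`, `c = 1/3`) carried over unchanged:
the model chart and the manifold chart both have the ADM form of `schwarzschildAreal m` on the open late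
exterior, which is all the collar sentence reads of a chart (`HasUniformCollarControl.of_hasADMForm`).
Conditional on `[Kerr.Facts]` through `staticMetric`. [cite: Ellithy2026, Def. 4.4, p. 39; Remark 4.6, p. 40] -/
theorem staticMetric_hasUniformCollarControl (hr₀ : 0 < r₀) (hm : 4 * |m| ≤ r₀) (Tlo : ℝ) :
    HasUniformCollarControl 𝓘(ℝ, E4) (M := Kerr.exterior m 0) (staticMetric m).val
      (lateChart m r₀ hr₀ hm) Tlo r₀ :=
  (schwarzschildStatic_hasUniformCollarControl hr₀ hm Tlo).of_hasADMForm
    (schwarzschildStatic_hasADMForm hr₀ Tlo) (staticMetric_hasADMForm hr₀ hm Tlo)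

/-- **The Schwarzschild exterior `(Kerr.exterior m 0, g_static)` with its late chart inhabits the assembled
predicate `IsQuasiFinalAnalyticCollar`** — Def. 4.4 (1) (ADM form, tuple in `𝒞𝒮♯_{-τ}`, collar
sentence) + (2) (gauge reducibility, forcing decay) + §4.1 rest frame — for every `r₀ > 0` with
`r₀ ≥ 4|m|` and every `T̲`; the positive-mass, manifold-level counterpart of
`Minkowski.spacetime_isQuasiFinalAnalyticCollar` (modulo `[Kerr.Facts]`).  The geometric horizon clauses
of Def. 4.4 and the orientation clause of §4.1 are not part of this predicate.
[cite: Ellithy2026, Def. 4.4, p. 39; Remark 4.6, p. 40] -/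
theorem staticMetric_isQuasiFinalAnalyticCollar (hr₀ : 0 < r₀) (hm : 4 * |m| ≤ r₀) (Tlo : ℝ) :
    IsQuasiFinalAnalyticCollar 𝓘(ℝ, E4) (M := Kerr.exterior m 0) (staticMetric m).val
      (lateChart m r₀ hr₀ hm) Tlo r₀ :=
  ⟨staticMetric_isQuasiFinalAnalytic hr₀ hm Tlo, staticMetric_hasUniformCollarControl hr₀ hm Tlo⟩

end Schwarzschild

end Literature.Geometry.Lorentzian

end
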